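import Literature.AnabelianGeometry.SemiGraphs.TemperedProfinitelyClosedSubgroups
import Literature.AnabelianGeometry.SemiGraphs.TemperedDecompositionSubgroups
import Literature.AnabelianGeometry.SemiGraphs.TemperedPiCharacteristicTowerOfCharCores
import Literature.AnabelianGeometry.SemiGraphs.TemperedPiCompactOfNoClosedEdge
import HarnessLib

/-!
# `Π̂_ℍ ∩ Π^tp_𝔾 = Π^tp_ℍ` modulo CLOSEDNESS of `Π^tp_ℍ` — [IUTchI] Cor. 2.3 (v) for the decomposition subgroups
# of a sub-semi-graph, from the André towers of `π₁^temp` ([SemiAnbd] Prop. 3.6) and M. Hall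

Mochizuki, *Inter-universal Teichmüller theory I*, §2 p. 44 (decomposition groups `Π^tp_ℍ ⊆ Π^tp_𝔾`,
`Π̂_ℍ ⊆ Π̂_𝔾`), Cor. 2.3 (v) p. 48 «`Δ̂_{X,ℍ} ∩ Δ^tp_X = Δ^tp_{X,ℍ}`», proof p. 49 l. −9 – p. 50 l. 2 («it suffices
to verify … for a nonabelian finitely generated free discrete group `G`: for any finitely generated subgroup
`F ⊆ G` … `F̂ ∩ G = F`» — [SemiAnbd] Cor. 1.6 (ii) / M. Hall) [cite: Mochizuki2012, IUTchI Cor 2.3(v) pp.49-50]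
(`[claim: Mochizuki2012, status: disputed]`; nothing of the series is asserted); Mochizuki, *Semi-graphs of
anabelioids* (2006), Prop. 3.6 p. 38 [cite: MochizukiSemiAnbd2006, Prop 3.6 p.38].

PROOF-ONLY file (abc-iut cell, layer L3, row «DECOMP-PROFINITE» sequel = sub-row (P1) of GAP row G-w5d028-2,
seat abc-iut-w5-d240 gen 6; no definition, no instance, no new named fact).  Instantiation of the engine
`TemperedProfinitelyClosedSubgroups.lean` at the decomposition subgroups `D ∈ c.decompSubgroups ℍ`
(abc-iut-w4-d052, `TemperedDecompositionSubgroups.lean`) of a chart `c` of `π₁^temp(𝒢)`: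

* `fg_map_mk'_of_mem_decompSubgroups` — the images of `D = range φ` at the open normal levels `M` of
  `π₁^temp(𝒢)` are FINITELY GENERATED: an André level of `π₁^temp(𝒢_ℍ)` inside `φ⁻¹(M)`
  (`charTower_of_coherent`, abc-iut-w5-d240 gen 5: virtually free finitely generated quotient) when `ℍ`
  has a closed edge, compactness of `π₁^temp(𝒢_ℍ)` (`compactSpace_of_forall_not_isClosedEdge`) otherwise;
* **`comap_topologicalClosure_map_eq_of_mem_decompSubgroups_of_isClosed`** — for `𝒢`, `𝒢_ℍ` FINITE coherent
  Prop-3.6 graphs, `𝒢` with a closed edge, ANY profinite completion `ι` and ANY `D ∈ c.decompSubgroups ℍ`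
  CLOSED in `π₁^temp(𝒢)`: `ι⁻¹(closure ι(D)) = D` (abc-iut-L5's `cor23v_of_graph` input
  «`Π̂_ℍ ∩ Π^tp_𝔾 = Π^tp_ℍ`» at `Π̂_ℍ := closure ι(Π^tp_ℍ)`); set form
  `topologicalClosure_map_inf_range_eq_of_mem_decompSubgroups_of_isClosed`;
* `comap_topologicalClosure_map_eq_of_mem_decompSubgroups_of_forall_not_isClosedEdge` — the closedness
  hypothesis DISCHARGED when `ℍ` has no closed edge (`Π^tp_ℍ` compact; `π₁^temp(𝒢)` Hausdorff).

HONEST RESIDUAL ((P1) of G-w5d028-2 after this file): «decomposition subgroups `Π^tp_ℍ = range φ` are CLOSED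
in `π₁^temp(𝒢)`» for `ℍ` WITH a closed edge (necessary — profinitely closed ⇒ closed; the statement that the
decomposition homomorphism `φ` is a closed embedding, the remaining content of print's «immediately from the
definitions»), displayed as `hDcl`; not a published-prerequisite gap.  Nothing here takes a side on
[IUTchIII] Cor. 3.12; typed ≠ proved for the [IUTchI] claim keys.
-/

noncomputable section

namespace Literature.AnabelianGeometry.SemiGraphs

namespace ProfiniteSemiGraph

open Topology

universe u v

/-! ### Helpers: finitely generated images at a level -/

/-- A group with a finitely generated subgroup of finite index is finitely generated (generators of the
subgroup together with coset representatives). [folklore] -/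
private theorem groupFG_of_finiteIndex {Q : Type u} [Group Q] (K : Subgroup Q) [K.FiniteIndex]
    (hK : Group.FG K) : Group.FG Q := by
  classical
  haveI : Finite (Q ⧸ K) := Subgroup.finite_quotient_of_finiteIndex
  haveI : Fintype (Q ⧸ K) := Fintype.ofFinite _
  obtain ⟨S, hS⟩ := (Group.fg_iff_subgroup_fg K).1 hK
  refine ⟨⟨S ∪ (Finset.univ.image fun q : Q ⧸ K => (Quotient.out q : Q)), ?_⟩⟩
  rw [eq_top_iff]
  intro q _
  rw [Finset.coe_union, Subgroup.closure_union]
  have hr : (Quotient.out (QuotientGroup.mk q : Q ⧸ K) : Q)⁻¹ * q ∈ K :=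
    QuotientGroup.eq.1 (QuotientGroup.out_eq' (QuotientGroup.mk q : Q ⧸ K))
  have hq : q = (Quotient.out (QuotientGroup.mk q : Q ⧸ K) : Q) *
      ((Quotient.out (QuotientGroup.mk q : Q ⧸ K) : Q)⁻¹ * q) := by group
  rw [hq]
  refine Subgroup.mul_mem _ (Subgroup.mem_sup_right (Subgroup.subset_closure ?_))
    (Subgroup.mem_sup_left ?_)
  · simp
  · rw [hS]; exact hr

/-- A free group on finitely many generators is finitely generated. [folklore] -/
private theorem groupFG_of_isFreeGroup {G : Type u} [Group G] [IsFreeGroup G]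
    [Finite (IsFreeGroup.Generators G)] : Group.FG G :=
  Group.fg_of_surjective (f := (IsFreeGroup.toFreeGroup G).symm.toMonoidHom)
    (IsFreeGroup.toFreeGroup G).symm.surjective

/-- The image of `Γ'` in `Γ/M` along `φ` is finitely generated as soon as `Γ'/M'` is, for a normal
`M' ≤ φ⁻¹(M)`. [folklore] -/
private theorem fg_range_mk'_comp {Γ' Γ : Type u} [Group Γ'] [Group Γ] (φ : Γ' →* Γ) (M : Subgroup Γ)
    [M.Normal] (M' : Subgroup Γ') [M'.Normal] (hle : M' ≤ M.comap φ) (hfg : Group.FG (Γ' ⧸ M')) :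
    ((QuotientGroup.mk' M).comp φ).range.FG := by
  have hker : M' ≤ ((QuotientGroup.mk' M).comp φ).ker := fun x hx => by
    rw [MonoidHom.mem_ker, MonoidHom.comp_apply, QuotientGroup.mk'_apply, QuotientGroup.eq_one_iff]
    exact hle hx
  have hcomp : (QuotientGroup.lift M' _ hker).comp (QuotientGroup.mk' M') = (QuotientGroup.mk' M).comp φ :=
    MonoidHom.ext fun _ => rfl
  have hrange : ((QuotientGroup.mk' M).comp φ).range = (QuotientGroup.lift M' _ hker).range := by
    conv_lhs => rw [← hcomp]
    rw [MonoidHom.range_comp, MonoidHom.range_eq_top.2 (QuotientGroup.mk'_surjective M'),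
      ← MonoidHom.range_eq_map]
  rw [← Group.fg_iff_subgroup_fg, hrange]
  haveI := hfg
  infer_instance

namespace TemperedPiChart

variable {𝒢 : ProfiniteSemiGraph.{u}}

/-- **The images of a decomposition subgroup at the open normal levels of `π₁^temp(𝒢)` are finitely
generated** (`𝒢_ℍ` FINITE, coherent, Prop. 3.6): for `D = range φ ∈ c.decompSubgroups ℍ` and every open
normal `M ⊴ π₁^temp(𝒢)`, the image of `D` in `π₁^temp(𝒢)/M` is finitely generated — by the André tower of
`π₁^temp(𝒢_ℍ)` inside `φ⁻¹(M)` (`charTower_of_coherent`: a virtually free, finitely generated quotient)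
when `ℍ` has a closed edge, by compactness of `π₁^temp(𝒢_ℍ)` (`compactSpace_of_forall_not_isClosedEdge`)
otherwise. [cite: MochizukiSemiAnbd2006, Prop 3.6 p.38] -/
theorem fg_map_mk'_of_mem_decompSubgroups {H : 𝒢.graph.Subgraph} [Finite (𝒢.restrict H).graph.Vertex]
    [Finite (𝒢.restrict H).graph.Edge] (h36' : (𝒢.restrict H).Prop36Hypotheses)
    (hcoh' : (𝒢.restrict H).IsCoherent) (c : TemperedPiChart 𝒢) {D : Subgroup c.G}
    (hD : D ∈ c.decompSubgroups H) (M : OpenNormalSubgroup c.G) :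
    (D.map (QuotientGroup.mk' M.toSubgroup)).FG := by
  obtain ⟨c', φ, -, rfl⟩ := hD
  haveI : M.toSubgroup.Normal := M.isNormal'
  haveI := c'.isTopologicalGroup
  rw [← MonoidHom.range_comp]
  -- the open normal subgroup `φ⁻¹(M)` of `π₁^temp(𝒢_ℍ)`
  have hVopen : IsOpen ((M.toSubgroup.comap φ.toMonoidHom : Subgroup c'.G) : Set c'.G) :=
    M.isOpen'.preimage φ.continuous
  haveI : (M.toSubgroup.comap φ.toMonoidHom).Normal := Subgroup.Normal.comap inferInstance _
  by_cases hcl' : ∃ e : (𝒢.restrict H).graph.Edge, (𝒢.restrict H).graph.IsClosedEdge e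
  · -- an André level `M' ⊆ φ⁻¹(M)` of `π₁^temp(𝒢_ℍ)` with virtually free finitely generated quotient
    obtain ⟨M', hM'V, -, G', hG', hG'fi, hG'fin, -⟩ := c'.charTower_of_coherent h36' hcoh' hcl'
      ((M.toSubgroup.comap φ.toMonoidHom : Subgroup c'.G) : Set c'.G)
      (hVopen.mem_nhds (Subgroup.one_mem _))
    haveI : M'.toSubgroup.Normal := M'.isNormal'
    haveI := hG'
    haveI := hG'fi
    haveI := hG'fin
    exact fg_range_mk'_comp φ.toMonoidHom M.toSubgroup M'.toSubgroup (fun x hx => hM'V hx)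
      (groupFG_of_finiteIndex G' groupFG_of_isFreeGroup)
  · -- no closed edge: `π₁^temp(𝒢_ℍ)` is compact, `φ⁻¹(M)` has finite index
    push Not at hcl'
    haveI : CompactSpace c'.G := c'.compactSpace_of_forall_not_isClosedEdge h36' hcl'
    haveI : Finite (c'.G ⧸ (M.toSubgroup.comap φ.toMonoidHom)) :=
      Subgroup.quotient_finite_of_isOpen _ hVopen
    exact fg_range_mk'_comp φ.toMonoidHom M.toSubgroup (M.toSubgroup.comap φ.toMonoidHom) le_rfl
      inferInstance

/-- **[IUTchI] Cor. 2.3 (v) for the decomposition subgroups of a sub-semi-graph, MODULO CLOSEDNESS**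
(§2 p. 44; Cor. 2.3 (v) p. 48 «`Δ̂_{X,ℍ} ∩ Δ^tp_X = Δ^tp_{X,ℍ}`», proof p. 49 l. −9 – p. 50 l. 2 «`F̂ ∩ G = F`»):
let `𝒢` and `𝒢_ℍ` be FINITE, coherent semi-graphs of anabelioids satisfying the hypotheses of [SemiAnbd]
Prop. 3.6, `𝒢` with a closed edge, `c` a chart of `π₁^temp(𝒢)`, `ι : π₁^temp(𝒢) → Π̂` ANY profinite
completion, and `D = Π^tp_ℍ ∈ c.decompSubgroups ℍ` a decomposition subgroup which is CLOSED in `π₁^temp(𝒢)`.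
Then `ι⁻¹(closure ι(D)) = D` — `Π^tp_ℍ` is closed for the profinite topology of `Π^tp_𝔾`, i.e. abc-iut-L5's
`cor23v_of_graph` input «`Π̂_ℍ ∩ Π^tp_𝔾 = Π^tp_ℍ`» at `Π̂_ℍ := closure ι(Π^tp_ℍ)`.  Chain: André levels of
`π₁^temp(𝒢)` (`charTower_of_coherent`: virtually free quotients), finitely generated images
(`fg_map_mk'_of_mem_decompSubgroups`), separability of finitely generated subgroups of virtually free groups
(M. Hall, `TemperedProfinitelyClosedSubgroups.lean`).  HONEST RESIDUAL: the closedness hypothesis `hDcl`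
(necessary; automatic when `ℍ` has no closed edge, `Π^tp_ℍ` being then compact) — the statement that the
decomposition homomorphism is a closed embedding.  The [IUTchI] sentence is a
`[claim: Mochizuki2012, status: disputed]` item; PROVED is the displayed group-theoretic statement.
[cite: Mochizuki2012, IUTchI Cor 2.3(v) pp.49-50] -/
theorem comap_topologicalClosure_map_eq_of_mem_decompSubgroups_of_isClosed {H : 𝒢.graph.Subgraph}
    [Finite 𝒢.graph.Vertex] [Finite 𝒢.graph.Edge] [Finite (𝒢.restrict H).graph.Vertex]
    [Finite (𝒢.restrict H).graph.Edge] (h36 : 𝒢.Prop36Hypotheses) (hcoh : 𝒢.IsCoherent)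
    (hcl : ∃ e : 𝒢.graph.Edge, 𝒢.graph.IsClosedEdge e) (h36' : (𝒢.restrict H).Prop36Hypotheses)
    (hcoh' : (𝒢.restrict H).IsCoherent) (c : TemperedPiChart 𝒢) {P : Type v} [Group P]
    [TopologicalSpace P] [IsTopologicalGroup P] {ι : c.G →ₜ* P} (hι : IsProfiniteCompletion ι)
    {D : Subgroup c.G} (hD : D ∈ c.decompSubgroups H) (hDcl : IsClosed (D : Set c.G)) :
    ((D.map ι.toMonoidHom).topologicalClosure).comap ι.toMonoidHom = D := by
  haveI := c.isTopologicalGroup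
  refine hι.comap_topologicalClosure_map_eq_of_isClosed_of_virtuallyFree_levels D hDcl
    (fun W hW => ?_) (fun M => fg_map_mk'_of_mem_decompSubgroups h36' hcoh' c hD M)
  obtain ⟨M, hMW, -, G, hG, hGfi, -, -⟩ := c.charTower_of_coherent h36 hcoh hcl W hW
  exact ⟨M, hMW, G, hG, hGfi⟩

/-- The same with the conclusion in the «`Π̂_ℍ ∩ ι(Π^tp_𝔾) = ι(Π^tp_ℍ)`» set form.
[cite: Mochizuki2012, IUTchI Cor 2.3(v) pp.49-50] -/
theorem topologicalClosure_map_inf_range_eq_of_mem_decompSubgroups_of_isClosed {H : 𝒢.graph.Subgraph}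
    [Finite 𝒢.graph.Vertex] [Finite 𝒢.graph.Edge] [Finite (𝒢.restrict H).graph.Vertex]
    [Finite (𝒢.restrict H).graph.Edge] (h36 : 𝒢.Prop36Hypotheses) (hcoh : 𝒢.IsCoherent)
    (hcl : ∃ e : 𝒢.graph.Edge, 𝒢.graph.IsClosedEdge e) (h36' : (𝒢.restrict H).Prop36Hypotheses)
    (hcoh' : (𝒢.restrict H).IsCoherent) (c : TemperedPiChart 𝒢) {P : Type v} [Group P]
    [TopologicalSpace P] [IsTopologicalGroup P] {ι : c.G →ₜ* P} (hι : IsProfiniteCompletion ι)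
    {D : Subgroup c.G} (hD : D ∈ c.decompSubgroups H) (hDcl : IsClosed (D : Set c.G)) :
    (D.map ι.toMonoidHom).topologicalClosure ⊓ ι.toMonoidHom.range = D.map ι.toMonoidHom := by
  have h := comap_topologicalClosure_map_eq_of_mem_decompSubgroups_of_isClosed h36 hcoh hcl h36' hcoh' c
    hι hD hDcl
  apply le_antisymm
  · rintro x ⟨hx, ⟨g, rfl⟩⟩
    have hg : g ∈ ((D.map ι.toMonoidHom).topologicalClosure).comap ι.toMonoidHom := hx
    rw [h] at hg
    exact Subgroup.mem_map_of_mem _ hg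
  · exact le_inf (Subgroup.le_topologicalClosure _) (Subgroup.map_le_range _ _)

/-- **The closedness hypothesis discharged when `ℍ` has NO closed edge**: then `π₁^temp(𝒢_ℍ)` is compact
(`compactSpace_of_forall_not_isClosedEdge`), so `Π^tp_ℍ = range φ` is compact, hence closed in the Hausdorff
group `π₁^temp(𝒢)`, and `ι⁻¹(closure ι(Π^tp_ℍ)) = Π^tp_ℍ` holds outright.
[cite: Mochizuki2012, IUTchI Cor 2.3(v) pp.49-50] -/
theorem comap_topologicalClosure_map_eq_of_mem_decompSubgroups_of_forall_not_isClosedEdge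
    {H : 𝒢.graph.Subgraph} [Finite 𝒢.graph.Vertex] [Finite 𝒢.graph.Edge]
    [Finite (𝒢.restrict H).graph.Vertex] [Finite (𝒢.restrict H).graph.Edge] (h36 : 𝒢.Prop36Hypotheses)
    (hcoh : 𝒢.IsCoherent) (hcl : ∃ e : 𝒢.graph.Edge, 𝒢.graph.IsClosedEdge e)
    (h36' : (𝒢.restrict H).Prop36Hypotheses) (hcoh' : (𝒢.restrict H).IsCoherent)
    (hcl' : ∀ e : (𝒢.restrict H).graph.Edge, ¬ (𝒢.restrict H).graph.IsClosedEdge e)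
    (c : TemperedPiChart 𝒢) [T2Space c.G] {P : Type v} [Group P] [TopologicalSpace P]
    [IsTopologicalGroup P] {ι : c.G →ₜ* P} (hι : IsProfiniteCompletion ι) {D : Subgroup c.G}
    (hD : D ∈ c.decompSubgroups H) :
    ((D.map ι.toMonoidHom).topologicalClosure).comap ι.toMonoidHom = D := by
  have hDcl : IsClosed (D : Set c.G) := by
    obtain ⟨c', φ, -, rfl⟩ := hD
    haveI : CompactSpace c'.G := c'.compactSpace_of_forall_not_isClosedEdge h36' hcl'
    rw [MonoidHom.coe_range]
    exact (isCompact_range φ.continuous).isClosed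
  exact comap_topologicalClosure_map_eq_of_mem_decompSubgroups_of_isClosed h36 hcoh hcl h36' hcoh' c hι hD
    hDcl

end TemperedPiChart

end ProfiniteSemiGraph

end Literature.AnabelianGeometry.SemiGraphs

end
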